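import Summits.Ventures.LatticeQCDFlow.TrivializingMaps.SpecificHeatAnyGroup
import Summits.Ventures.LatticeQCDFlow.TrivializingMaps.ReweightingStepLaw

/-!
HONEST FRAMING: exact (Metropolis-corrected) sampling algorithms for lattice gauge theory; figures
of merit are autocorrelation/cost numbers at stated couplings and volumes; no continuum-physics
claim.

# ReweightingStepLawAnyGroup — THE ONE-STEP REWEIGHTING LAW FOR EVERY COMPACT GAUGE GROUP:
# `E_{μ_β}[(dμ_{β+δ}/dμ_β)²] = exp(∫_β^{β+δ}∫_t^{t+δ} Var_u(S_W^ρ) du dt)` (lean-2 GEN-8, ours)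

Venture-side (OURS).  Cell `lqcd-flow` (pub-lqcd), unit `pub-lqcd-lean-2-g8`, 2026-08-22.  The
every-compact-group version of `ReweightingStepLaw` / `AnnealingThermodynamicLength` (there: smooth
actions on `SU(n)^E` through the ambient dictionary): here `G` is any compact second-countable group,
`ρ` any continuous matrix representation, `S = S_W^ρ` Wave 0's Wilson action, `μ_t = wilsonMeasure ρ t`,
and the dictionary is `SpecificHeatAnyGroup` (`ψ = cgf(-S_W^ρ)`, `ψ″(t) = Var_{μ_t}(S_W^ρ)`):

* §1–§2 `cgf_second_difference_eq_anyGroup` (`ψ(β+2δ) − 2ψ(β+δ) + ψ(β) = ∫_β^{β+δ}∫_t^{t+δ} Var`),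
  `…_ge/_le_anyGroup`; §3 `weight_sq_integral_eq_anyGroup` (`E_{μ_β}[(e^{-δS}Z(β)/Z(β+δ))²] = exp(Δ²ψ)`)
  and the bounds `exp(δ²m) ≤ … ≤ exp(δ²M)`;
* the strong-coupling instances (every compact `G`; `U(1)`: `E[w²] ≥ exp(δ²·#plaq/4)` per step, a
  `k`-step schedule costs `≥ #plaq·(β_k − β_0)²/(4k)`) are the sequel `AnnealingAnyGroup`.

NOT CLAIMED: finite-sample ESS statements; cost / autocorrelation / continuum statements.  Literature grade (cell rule): elementary; new typing.
-/

noncomputable section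

open MeasureTheory ProbabilityTheory Complex Metric Set Filter Topology intervalIntegral
open Literature.MathematicalPhysics.QuantumFieldTheory
open Literature.MathematicalPhysics.QuantumFieldTheory.Luscher2010
open scoped Matrix Matrix.Norms.Frobenius ContDiff

namespace Summit.Ventures.LatticeQCDFlow.TrivializingMaps

/-! ## §1 The cumulant generating function of `-S_W^ρ`: derivatives (dictionary of `SpecificHeatAnyGroup`) -/

section CGF

variable {d L N : ℕ} [NeZero L] {G : Type*} [Group G] [TopologicalSpace G] [IsTopologicalGroup G]
  [CompactSpace G] [MeasurableSpace G] [BorelSpace G] [SecondCountableTopology G]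
  {ρ : G →* Matrix (Fin N) (Fin N) ℂ}

/-- `ψ′` has derivative `ψ″ = Var_{μ_t}(S_W^ρ)` everywhere. [folklore] -/
theorem hasDerivAt_deriv_cgf_anyGroup (hρ : Continuous ρ) (t : ℝ) :
    HasDerivAt (deriv (cgf (fun U => -wilsonAction ρ U) (trivialMeasure G d L)))
      (variance (wilsonAction (d := d) (L := L) ρ) (wilsonMeasure (d := d) (L := L) ρ t)) t := by
  have hA := (cgf_neg_wilsonAction_analyticOnNhd (d := d) (L := L) ρ hρ).deriv
  have h := (hA t (Set.mem_univ t)).differentiableAt.hasDerivAt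
  rw [← iteratedDeriv_two_cgf_eq_variance_wilsonMeasure ρ hρ t, iteratedDeriv_succ, iteratedDeriv_one]
  exact h

/-- `ψ` has derivative `ψ′` everywhere. [folklore] -/
theorem hasDerivAt_cgf_anyGroup (hρ : Continuous ρ) (t : ℝ) :
    HasDerivAt (cgf (fun U => -wilsonAction ρ U) (trivialMeasure G d L))
      (deriv (cgf (fun U => -wilsonAction ρ U) (trivialMeasure G d L)) t) t :=
  ((cgf_neg_wilsonAction_analyticOnNhd (d := d) (L := L) ρ hρ) t (Set.mem_univ t)).differentiableAt.hasDerivAt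

/-- `t ↦ Var_{μ_t}(S_W^ρ)` is continuous (it is `ψ″`, `ψ` analytic). [folklore] -/
theorem continuous_variance_wilsonMeasure (hρ : Continuous ρ) :
    Continuous fun t : ℝ => variance (wilsonAction (d := d) (L := L) ρ) (wilsonMeasure (d := d) (L := L) ρ t) := by
  have hA := ((cgf_neg_wilsonAction_analyticOnNhd (d := d) (L := L) ρ hρ).deriv).deriv
  have hc : Continuous (deriv (deriv (cgf (fun U => -wilsonAction ρ U) (trivialMeasure G d L)))) :=
    continuousOn_univ.1 hA.continuousOn
  refine hc.congr fun t => ?_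
  have h := iteratedDeriv_two_cgf_eq_variance_wilsonMeasure (d := d) (L := L) ρ hρ t
  rw [iteratedDeriv_succ, iteratedDeriv_one] at h
  exact h

end CGF

/-! ## §2 The second difference of `ψ = log Z` is a double integral of the variance -/

section SecondDifference

variable {d L N : ℕ} [NeZero L] {G : Type*} [Group G] [TopologicalSpace G] [IsTopologicalGroup G]
  [CompactSpace G] [MeasurableSpace G] [BorelSpace G] [SecondCountableTopology G]
  {ρ : G →* Matrix (Fin N) (Fin N) ℂ}

/-- **EXACT LAW: `ψ(β+2δ) − 2ψ(β+δ) + ψ(β) = ∫_β^{β+δ} ∫_t^{t+δ} Var_u(S∘ι) du dt`** for every smooth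
action, every volume, every real `β`, `δ`. [ours] -/
theorem cgf_second_difference_eq_anyGroup (hρ : Continuous ρ) (β δ : ℝ) :
    cgf (fun U => -wilsonAction ρ U) (trivialMeasure G d L)
        (β + 2 * δ) -
      2 * cgf (fun U => -wilsonAction ρ U) (trivialMeasure G d L)
        (β + δ) +
      cgf (fun U => -wilsonAction ρ U) (trivialMeasure G d L) β =
      ∫ t in β..β + δ, ∫ u in t..t + δ, variance (wilsonAction (d := d) (L := L) ρ) (wilsonMeasure (d := d) (L := L) ρ u) := by
  set ψ := cgf (fun U => -wilsonAction ρ U) (trivialMeasure G d L) with hψdef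
  set V : ℝ → ℝ := fun u => variance (wilsonAction (d := d) (L := L) ρ) (wilsonMeasure (d := d) (L := L) ρ u) with hVdef
  have hVc : Continuous V := continuous_variance_wilsonMeasure hρ
  have hψ' : ∀ t, HasDerivAt ψ (deriv ψ t) t := hasDerivAt_cgf_anyGroup hρ
  have hψ'' : ∀ t, HasDerivAt (deriv ψ) (V t) t := hasDerivAt_deriv_cgf_anyGroup hρ
  have hψ'c : Continuous (deriv ψ) := continuous_iff_continuousAt.2 fun t => (hψ'' t).continuousAt
  -- FTC for `ψ` and for `ψ'`
  have h1 : ∀ a b : ℝ, ψ b - ψ a = ∫ t in a..b, deriv ψ t := fun a b =>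
    (integral_eq_sub_of_hasDerivAt (fun t _ => hψ' t) (hψ'c.intervalIntegrable a b)).symm
  have h2 : ∀ a b : ℝ, deriv ψ b - deriv ψ a = ∫ u in a..b, V u := fun a b =>
    (integral_eq_sub_of_hasDerivAt (fun t _ => hψ'' t) (hVc.intervalIntegrable a b)).symm
  -- the second difference as an integral of first differences of `ψ'`
  have hshift : ∫ t in β..β + δ, deriv ψ (t + δ) = ∫ t in β + δ..β + 2 * δ, deriv ψ t := by
    rw [intervalIntegral.integral_comp_add_right (fun t => deriv ψ t) δ]
    congr 1
    ring
  have hfi : IntervalIntegrable (fun t => deriv ψ (t + δ)) volume β (β + δ) :=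
    (hψ'c.comp (continuous_add_const δ)).intervalIntegrable _ _
  have hgi : IntervalIntegrable (fun t => deriv ψ t) volume β (β + δ) := hψ'c.intervalIntegrable _ _
  calc ψ (β + 2 * δ) - 2 * ψ (β + δ) + ψ β
      = (ψ (β + 2 * δ) - ψ (β + δ)) - (ψ (β + δ) - ψ β) := by ring
    _ = (∫ t in β..β + δ, deriv ψ (t + δ)) - ∫ t in β..β + δ, deriv ψ t := by
        rw [h1, h1, hshift]
    _ = ∫ t in β..β + δ, (deriv ψ (t + δ) - deriv ψ t) := by
        rw [intervalIntegral.integral_sub hfi hgi]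
    _ = ∫ t in β..β + δ, ∫ u in t..t + δ, V u := by
        refine intervalIntegral.integral_congr fun t _ => ?_
        exact h2 t (t + δ)

/-- **LOWER BOUND: if `m ≤ Var_u(S∘ι)` for `u ∈ [β, β+2δ]` (`δ ≥ 0`) then
`ψ(β+2δ) − 2ψ(β+δ) + ψ(β) ≥ δ²·m`.** [ours] -/
theorem cgf_second_difference_ge_anyGroup (hρ : Continuous ρ) {β δ m : ℝ} (hδ : 0 ≤ δ)
    (hm : ∀ u ∈ Icc β (β + 2 * δ), m ≤ variance (wilsonAction (d := d) (L := L) ρ) (wilsonMeasure (d := d) (L := L) ρ u)) :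
    δ ^ 2 * m ≤
      cgf (fun U => -wilsonAction ρ U) (trivialMeasure G d L)
          (β + 2 * δ) -
        2 * cgf (fun U => -wilsonAction ρ U) (trivialMeasure G d L)
          (β + δ) +
        cgf (fun U => -wilsonAction ρ U) (trivialMeasure G d L) β := by
  set V : ℝ → ℝ := fun u => variance (wilsonAction (d := d) (L := L) ρ) (wilsonMeasure (d := d) (L := L) ρ u) with hVdef
  have hVc : Continuous V := continuous_variance_wilsonMeasure hρ
  rw [cgf_second_difference_eq_anyGroup hρ β δ]
  -- inner integrals are at least `δ m`
  have hinner : ∀ t ∈ Icc β (β + δ), δ * m ≤ ∫ u in t..t + δ, V u := by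
    intro t ht
    have hconst : ∫ _ in t..t + δ, m = δ * m := by
      rw [intervalIntegral.integral_const, smul_eq_mul]; ring
    rw [← hconst]
    refine intervalIntegral.integral_mono_on (by linarith) (continuous_const.intervalIntegrable _ _)
      (hVc.intervalIntegrable _ _) fun u hu => hm u ⟨by linarith [ht.1, hu.1], by linarith [ht.2, hu.2]⟩
  have hconst : ∫ _ in β..β + δ, δ * m = δ ^ 2 * m := by
    rw [intervalIntegral.integral_const, smul_eq_mul]; ring
  rw [← hconst]
  have hIc : Continuous fun t => ∫ u in t..t + δ, V u := by
    have h2 : ∀ t, ∫ u in t..t + δ, V u = (∫ u in (0:ℝ)..t + δ, V u) - ∫ u in (0:ℝ)..t, V u :=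
      fun t => (intervalIntegral.integral_interval_sub_left (hVc.intervalIntegrable _ _)
        (hVc.intervalIntegrable _ _)).symm
    simp_rw [h2]
    exact ((intervalIntegral.continuous_primitive (fun _ _ => hVc.intervalIntegrable _ _) 0).comp
      (continuous_add_const δ)).sub
      (intervalIntegral.continuous_primitive (fun _ _ => hVc.intervalIntegrable _ _) 0)
  exact intervalIntegral.integral_mono_on (by linarith) (continuous_const.intervalIntegrable _ _)
    (hIc.intervalIntegrable _ _) fun t ht => hinner t ht

/-- **UPPER BOUND: if `Var_u(S∘ι) ≤ M` for `u ∈ [β, β+2δ]` (`δ ≥ 0`) then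
`ψ(β+2δ) − 2ψ(β+δ) + ψ(β) ≤ δ²·M`.** [ours] -/
theorem cgf_second_difference_le_anyGroup (hρ : Continuous ρ) {β δ M : ℝ} (hδ : 0 ≤ δ)
    (hM : ∀ u ∈ Icc β (β + 2 * δ), variance (wilsonAction (d := d) (L := L) ρ) (wilsonMeasure (d := d) (L := L) ρ u) ≤ M) :
    cgf (fun U => -wilsonAction ρ U) (trivialMeasure G d L)
          (β + 2 * δ) -
        2 * cgf (fun U => -wilsonAction ρ U) (trivialMeasure G d L)
          (β + δ) +
        cgf (fun U => -wilsonAction ρ U) (trivialMeasure G d L) β ≤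
      δ ^ 2 * M := by
  set V : ℝ → ℝ := fun u => variance (wilsonAction (d := d) (L := L) ρ) (wilsonMeasure (d := d) (L := L) ρ u) with hVdef
  have hVc : Continuous V := continuous_variance_wilsonMeasure hρ
  rw [cgf_second_difference_eq_anyGroup hρ β δ]
  have hinner : ∀ t ∈ Icc β (β + δ), ∫ u in t..t + δ, V u ≤ δ * M := by
    intro t ht
    have hconst : ∫ _ in t..t + δ, M = δ * M := by
      rw [intervalIntegral.integral_const, smul_eq_mul]; ring
    rw [← hconst]
    refine intervalIntegral.integral_mono_on (by linarith) (hVc.intervalIntegrable _ _)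
      (continuous_const.intervalIntegrable _ _)
      fun u hu => hM u ⟨by linarith [ht.1, hu.1], by linarith [ht.2, hu.2]⟩
  have hconst : ∫ _ in β..β + δ, δ * M = δ ^ 2 * M := by
    rw [intervalIntegral.integral_const, smul_eq_mul]; ring
  rw [← hconst]
  have hIc : Continuous fun t => ∫ u in t..t + δ, V u := by
    have h2 : ∀ t, ∫ u in t..t + δ, V u = (∫ u in (0:ℝ)..t + δ, V u) - ∫ u in (0:ℝ)..t, V u :=
      fun t => (intervalIntegral.integral_interval_sub_left (hVc.intervalIntegrable _ _)
        (hVc.intervalIntegrable _ _)).symm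
    simp_rw [h2]
    exact ((intervalIntegral.continuous_primitive (fun _ _ => hVc.intervalIntegrable _ _) 0).comp
      (continuous_add_const δ)).sub
      (intervalIntegral.continuous_primitive (fun _ _ => hVc.intervalIntegrable _ _) 0)
  exact intervalIntegral.integral_mono_on (by linarith) (hIc.intervalIntegrable _ _)
    (continuous_const.intervalIntegrable _ _) fun t ht => hinner t ht

end SecondDifference

/-! ## §3 The second moment of the one-step reweighting weight -/

section Weight

variable {d L N : ℕ} [NeZero L] {G : Type*} [Group G] [TopologicalSpace G] [IsTopologicalGroup G]
  [CompactSpace G] [MeasurableSpace G] [BorelSpace G] [SecondCountableTopology G]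
  {ρ : G →* Matrix (Fin N) (Fin N) ℂ}

/-- **`E_{μ_β}[(e^{-δS} Z(β)/Z(β+δ))²] = exp(ψ(β+2δ) − 2ψ(β+δ) + ψ(β))`**: the second moment of the
importance weight `dμ_{β+δ}/dμ_β` of one exact reweighting step (`Z = mgf(-S∘ι)`, `ψ = log Z`).
[ours] -/
theorem weight_sq_integral_eq_anyGroup (hρ : Continuous ρ) (β δ : ℝ) :
    ∫ U, (Real.exp (-(δ * wilsonAction ρ U)) *
        (mgf (fun U => -wilsonAction ρ U) (trivialMeasure G d L) β /
          mgf (fun U => -wilsonAction ρ U) (trivialMeasure G d L)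
            (β + δ))) ^ 2
      ∂(wilsonMeasure (d := d) (L := L) ρ β) =
      Real.exp (cgf (fun U => -wilsonAction ρ U) (trivialMeasure G d L) (β + 2 * δ) -
          2 * cgf (fun U => -wilsonAction ρ U) (trivialMeasure G d L) (β + δ) +
          cgf (fun U => -wilsonAction ρ U) (trivialMeasure G d L) β) := by
  set D := trivialMeasure G d L with hD
  set X : GaugeConfig d L G → ℝ := fun U => -wilsonAction ρ U with hXdef
  haveI : IsProbabilityMeasure D := by rw [hD]; unfold trivialMeasure; infer_instance
  have hXc : Continuous X := (continuous_wilsonAction_of_continuous ρ hρ).neg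
  have hint : ∀ t : ℝ, Integrable (fun U => Real.exp (t * X U)) D := fun t =>
    integrable_trivialMeasure_of_continuous_group (Real.continuous_exp.comp (continuous_const.mul hXc))
  have hZpos : ∀ t : ℝ, 0 < mgf X D t := fun t => mgf_pos (hint t)
  have hμ : wilsonMeasure (d := d) (L := L) ρ β = D.tilted fun U => β * X U := by
    rw [hD, wilsonMeasure_eq_tilted_neg ρ hρ β]
  rw [hμ, integral_tilted]
  -- `∫ e^{βX}/Z(β) · (e^{δX} Z(β)/Z(β+δ))² dD = Z(β+2δ) Z(β) / Z(β+δ)²`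
  have hrw : ∀ U, (Real.exp (β * X U) / ∫ V, Real.exp (β * X V) ∂D) •
      (Real.exp (-(δ * wilsonAction ρ U)) * (mgf X D β / mgf X D (β + δ))) ^ 2 =
      (mgf X D β / mgf X D (β + δ) ^ 2) * Real.exp ((β + 2 * δ) * X U) := by
    intro U
    have hZ : ∫ V, Real.exp (β * X V) ∂D = mgf X D β := rfl
    rw [hZ, smul_eq_mul]
    have hexp : Real.exp (-(δ * wilsonAction ρ U)) = Real.exp (δ * X U) := by
      simp only [hXdef]; ring_nf
    rw [hexp]
    have h3 : Real.exp ((β + 2 * δ) * X U) = Real.exp (β * X U) * (Real.exp (δ * X U)) ^ 2 := by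
      rw [← Real.exp_nat_mul, ← Real.exp_add]; ring_nf
    rw [h3]
    have hZb : mgf X D β ≠ 0 := (hZpos β).ne'
    have hZd : mgf X D (β + δ) ≠ 0 := (hZpos (β + δ)).ne'
    field_simp
  simp_rw [hrw]
  rw [MeasureTheory.integral_const_mul]
  have hZ2 : ∫ U, Real.exp ((β + 2 * δ) * X U) ∂D = mgf X D (β + 2 * δ) := rfl
  rw [hZ2]
  have hψ : ∀ t, cgf X D t = Real.log (mgf X D t) := fun t => rfl
  have hA := hZpos (β + 2 * δ)
  have hB := hZpos (β + δ)
  have hC := hZpos β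
  rw [hψ, hψ, hψ, show Real.log (mgf X D (β + 2 * δ)) - 2 * Real.log (mgf X D (β + δ)) +
      Real.log (mgf X D β) = Real.log (mgf X D (β + 2 * δ) * mgf X D β / mgf X D (β + δ) ^ 2) by
    rw [Real.log_div (by positivity) (by positivity), Real.log_mul hA.ne' hC.ne', Real.log_pow]
    push_cast; ring]
  rw [Real.exp_log (by positivity)]
  field_simp

/-- **SECOND MOMENT OF THE ONE-STEP WEIGHT ≥ `exp(δ²·m)`** when `Var_u(S∘ι) ≥ m` on `[β, β+2δ]`
(`δ ≥ 0`). [ours] -/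
theorem weight_sq_integral_ge_exp_anyGroup (hρ : Continuous ρ) {β δ m : ℝ} (hδ : 0 ≤ δ)
    (hm : ∀ u ∈ Icc β (β + 2 * δ), m ≤ variance (wilsonAction (d := d) (L := L) ρ) (wilsonMeasure (d := d) (L := L) ρ u)) :
    Real.exp (δ ^ 2 * m) ≤
      ∫ U, (Real.exp (-(δ * wilsonAction ρ U)) *
        (mgf (fun U => -wilsonAction ρ U) (trivialMeasure G d L) β /
          mgf (fun U => -wilsonAction ρ U) (trivialMeasure G d L)
            (β + δ))) ^ 2
      ∂(wilsonMeasure (d := d) (L := L) ρ β) := by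
  rw [weight_sq_integral_eq_anyGroup hρ β δ]
  exact Real.exp_le_exp.2 (cgf_second_difference_ge_anyGroup hρ hδ hm)

/-- **SECOND MOMENT OF THE ONE-STEP WEIGHT ≤ `exp(δ²·M)`** when `Var_u(S∘ι) ≤ M` on `[β, β+2δ]`
(`δ ≥ 0`). [ours] -/
theorem weight_sq_integral_le_exp_anyGroup (hρ : Continuous ρ) {β δ M : ℝ} (hδ : 0 ≤ δ)
    (hM : ∀ u ∈ Icc β (β + 2 * δ), variance (wilsonAction (d := d) (L := L) ρ) (wilsonMeasure (d := d) (L := L) ρ u) ≤ M) :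
    ∫ U, (Real.exp (-(δ * wilsonAction ρ U)) *
        (mgf (fun U => -wilsonAction ρ U) (trivialMeasure G d L) β /
          mgf (fun U => -wilsonAction ρ U) (trivialMeasure G d L)
            (β + δ))) ^ 2
      ∂(wilsonMeasure (d := d) (L := L) ρ β) ≤ Real.exp (δ ^ 2 * M) := by
  rw [weight_sq_integral_eq_anyGroup hρ β δ]
  exact Real.exp_le_exp.2 (cgf_second_difference_le_anyGroup hρ hδ hM)

end Weight

end Summit.Ventures.LatticeQCDFlow.TrivializingMaps
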